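import Mathlib
import HarnessLib
import Summits.Ventures.LatticeQCDFlow.Scaling.AutoregressiveGaugePlaquetteMarginal

/-!
# LatticeQCDFlow / Scaling — THE VOLUME LAW IS SHARP IN THE VOLUME: the flat (Haar) proposal, which is
# endpoint-blind at every link, has `KL(e^{−βS_W}/Z ‖ Haar) ≤ 4|β|·N·#plaquettes = 2|β|·N·d(d−1)·#sites`

HONEST FRAMING: exact (Metropolis-corrected) sampling algorithms for lattice gauge theory;
figures of merit are autocorrelation/cost numbers at stated couplings and volumes; no
continuum-physics claim.

Venture `LatticeQCDFlow` (cell pub-lqcd), topic `Scaling`, FANOUT row 30 (lean-1, GEN-21) — OUR WORK on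
THEORY-2.md §4 row C5, the converse side of the lineage's volume laws (`(d·#sites/4)·m ≤ KL(e^{−βS_W}/Z ‖ H_l)`
for every autoregressive model whose conditionals ignore the links at one endpoint of their link).  The flat
proposal — all conditionals equal to `1`, i.e. independent Haar links — is such a model, and its divergence
from the Wilson law is at most LINEAR in the number of plaquettes: the laws are sharp in their volume
dependence, and what the per-link rate `m(β)` measures is the distance from this trivial ceiling.

## What is proved (all [ours]; compact `G`, continuous `ρ : G → M_N(ℂ)`, any real `β`, any `d`, `L`)

* **`abs_wilsonAction_le_two_mul_card`** — `|S_W(U)| ≤ 2N·#plaquettes` (`|Re tr ρ(g)| ≤ N`).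
* **`wilson_log_density_le`** — `log((e^{−βS_W(U)}/Z)) ≤ 4|β|·N·#plaquettes` pointwise.
* **`wilson_kl_flat_le`** — `∫ (F/Z)·log(F/Z) dπ ≤ 4|β|·N·#plaquettes` (`F = e^{−βS_W}`, `π = Haar^{⊗E}`):
  the relative entropy of the Wilson law with respect to the product Haar measure.
* **`wilson_kl_arHybrid_flat_le`** — the same quantity written as the lineage's hybrid divergence
  `KL(F/Z ‖ H_l)` for the flat autoregressive model (`q_a ≡ 1`) along any list `l` of ALL links
  (`A_l F = Z`, `∏ 1 = 1`): `≤ 4|β|·N·#plaquettes`.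

READING (value-free): between the floor `(d·#sites/4)·m(β)` of the endpoint-blind volume laws and this
ceiling `2|β|·N·d(d−1)·#sites` every endpoint-blind model's loss is squeezed; both are linear in the volume.
NOT CLAIMED: the true constant of the flat model (`= log Z⁻¹ − β⟨S_W⟩`, a free-energy statement); anything
about trained models beyond the floor/ceiling sandwich.  No `def`, no `sorry`, nothing cited as a fact.
-/

noncomputable section

namespace Summit.Ventures.LatticeQCDFlow.Theory2.Autoregressive

open MeasureTheory Function Set
open Literature.MathematicalPhysics.QuantumFieldTheory Literature.MathematicalPhysics.QuantumLattice
open Summit.Ventures.LatticeQCDFlow.Exactness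
open scoped Matrix Matrix.Norms.Frobenius

variable {d L N : ℕ} {G : Type*} [Group G] [TopologicalSpace G] [IsTopologicalGroup G]
  [CompactSpace G] [SecondCountableTopology G] [MeasurableSpace G] [BorelSpace G] [NeZero L]
  (ρ : G →* Matrix (Fin N) (Fin N) ℂ)

omit [SecondCountableTopology G] [MeasurableSpace G] [BorelSpace G] in
/-- `|S_W(U)| ≤ 2N·#plaquettes` for a continuous representation of a compact group. [ours] -/
theorem abs_wilsonAction_le_two_mul_card (hρ : Continuous ρ) (U : GaugeConfig d L G) :
    |wilsonAction ρ U| ≤ 2 * N * Fintype.card (Plaquette d L) := by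
  unfold wilsonAction
  refine (Finset.abs_sum_le_sum_abs _ _).trans ?_
  have hterm : ∀ p : Plaquette d L,
      |((N : ℝ) - (ρ (plaquetteHolonomy U p.1 p.2.1.1 p.2.1.2)).trace.re)| ≤ 2 * N := fun p => by
    have h := Literature.RepresentationTheory.CompactGroups.CompactGroup.abs_re_trace_le_card ρ hρ
      (plaquetteHolonomy U p.1 p.2.1.1 p.2.1.2)
    simp only [Fintype.card_fin] at h
    have h1 := (abs_sub _ _ : |((N : ℝ) - (ρ (plaquetteHolonomy U p.1 p.2.1.1 p.2.1.2)).trace.re)| ≤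
      |(N : ℝ)| + |(ρ (plaquetteHolonomy U p.1 p.2.1.1 p.2.1.2)).trace.re|)
    rw [Nat.abs_cast] at h1
    linarith
  calc ∑ p : Plaquette d L, |((N : ℝ) - (ρ (plaquetteHolonomy U p.1 p.2.1.1 p.2.1.2)).trace.re)|
      ≤ ∑ _p : Plaquette d L, (2 * N : ℝ) := Finset.sum_le_sum fun p _ => hterm p
    _ = 2 * N * Fintype.card (Plaquette d L) := by
        rw [Finset.sum_const, Finset.card_univ, nsmul_eq_mul]; ring

/-- **Pointwise: `log(e^{−βS_W(U)}/Z) ≤ 4|β|N·#plaquettes`.** [ours] -/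
theorem wilson_log_density_le (hρ : Continuous ρ) (β : ℝ) (U : GaugeConfig d L G) :
    Real.log (Real.exp (-β * wilsonAction ρ U) /
        ∫ W, Real.exp (-β * wilsonAction ρ W) ∂Measure.pi (fun _ : Edge d L => haarProbability G)) ≤
      4 * |β| * N * Fintype.card (Plaquette d L) := by
  set π := Measure.pi (fun _ : Edge d L => haarProbability G) with hπ
  set b : ℝ := |β| * (2 * N * Fintype.card (Plaquette d L)) with hb
  have hbd : ∀ W : GaugeConfig d L G, |-β * wilsonAction ρ W| ≤ b := fun W => by
    rw [abs_mul, abs_neg]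
    exact mul_le_mul_of_nonneg_left (abs_wilsonAction_le_two_mul_card ρ hρ W) (abs_nonneg _)
  have hlo : ∀ W : GaugeConfig d L G, Real.exp (-b) ≤ Real.exp (-β * wilsonAction ρ W) := fun W =>
    Real.exp_le_exp.2 (abs_le.1 (hbd W)).1
  have hhi : ∀ W : GaugeConfig d L G, Real.exp (-β * wilsonAction ρ W) ≤ Real.exp b := fun W =>
    Real.exp_le_exp.2 (abs_le.1 (hbd W)).2
  -- `Z ≥ e^{−b}`
  have hFm : Measurable fun W : GaugeConfig d L G => Real.exp (-β * wilsonAction ρ W) :=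
    Real.measurable_exp.comp ((measurable_wilsonAction ρ hρ).const_mul _)
  have hFi : Integrable (fun W : GaugeConfig d L G => Real.exp (-β * wilsonAction ρ W)) π :=
    Integrable.mono' (integrable_const (Real.exp b)) hFm.aestronglyMeasurable
      (ae_of_all _ fun W => by rw [Real.norm_eq_abs, abs_of_pos (Real.exp_pos _)]; exact hhi W)
  have hZlo : Real.exp (-b) ≤ ∫ W, Real.exp (-β * wilsonAction ρ W) ∂π := by
    have h1 : ∫ _ : GaugeConfig d L G, Real.exp (-b) ∂π ≤ ∫ W, Real.exp (-β * wilsonAction ρ W) ∂π :=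
      integral_mono (integrable_const _) hFi hlo
    have h2 : ∫ _ : GaugeConfig d L G, Real.exp (-b) ∂π = Real.exp (-b) := by
      rw [integral_const, smul_eq_mul, Measure.real, measure_univ, ENNReal.toReal_one, one_mul]
    linarith
  have hZpos : 0 < ∫ W, Real.exp (-β * wilsonAction ρ W) ∂π := (Real.exp_pos _).trans_le hZlo
  rw [Real.log_div (Real.exp_pos _).ne' hZpos.ne', Real.log_exp]
  have hlogZ : -b ≤ Real.log (∫ W, Real.exp (-β * wilsonAction ρ W) ∂π) := by
    have := Real.log_le_log (Real.exp_pos _) hZlo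
    rwa [Real.log_exp] at this
  have hS := (abs_le.1 (hbd U)).2
  have e : (4 : ℝ) * |β| * N * Fintype.card (Plaquette d L) = b + b := by rw [hb]; ring
  rw [e]
  linarith

/-- **The relative entropy of the Wilson law with respect to product Haar is at most `4|β|N·#plaquettes`**:
`∫ (F/Z)·log(F/Z) dπ ≤ 4|β|·N·#plaquettes`, `F = e^{−βS_W}`, `Z = ∫F dπ`. [ours] -/
theorem wilson_kl_flat_le (hρ : Continuous ρ) (β : ℝ) :
    ∫ U, Real.exp (-β * wilsonAction ρ U) /
          (∫ W, Real.exp (-β * wilsonAction ρ W) ∂Measure.pi (fun _ : Edge d L => haarProbability G)) *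
        Real.log (Real.exp (-β * wilsonAction ρ U) /
          ∫ W, Real.exp (-β * wilsonAction ρ W) ∂Measure.pi (fun _ : Edge d L => haarProbability G))
      ∂Measure.pi (fun _ : Edge d L => haarProbability G) ≤
      4 * |β| * N * Fintype.card (Plaquette d L) := by
  set π := Measure.pi (fun _ : Edge d L => haarProbability G) with hπ
  set F : GaugeConfig d L G → ℝ := fun U => Real.exp (-β * wilsonAction ρ U) with hF
  set Z : ℝ := ∫ W, F W ∂π with hZ
  set C : ℝ := 4 * |β| * N * Fintype.card (Plaquette d L) with hC
  obtain ⟨hFm, B, hFlo, hFhi⟩ := wilsonWeight_props (d := d) (L := L) ρ hρ β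
  have hZpos : 0 < Z :=
    integral_exp_pos (Literature.Probability.LatticeModels.integrable_of_continuous_compactSpace _
      (Real.continuous_exp.comp (continuous_const.mul (continuous_wilsonAction ρ hρ))))
  have hp0 : ∀ U, 0 ≤ F U / Z := fun U => div_nonneg (Real.exp_pos _).le hZpos.le
  have hlog : ∀ U, Real.log (F U / Z) ≤ C := fun U => wilson_log_density_le (d := d) (L := L) ρ hρ β U
  -- pointwise `(F/Z) log(F/Z) ≤ (F/Z)·C`, and `∫ F/Z = 1`
  have hpt : ∀ U, F U / Z * Real.log (F U / Z) ≤ F U / Z * C := fun U =>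
    mul_le_mul_of_nonneg_left (hlog U) (hp0 U)
  have hFi : Integrable F π :=
    Integrable.mono' (integrable_const (Real.exp (|β| * B))) hFm.aestronglyMeasurable
      (ae_of_all _ fun W => by rw [Real.norm_eq_abs, abs_of_pos (Real.exp_pos _)]; exact hFhi W)
  have hpi : Integrable (fun U => F U / Z) π := hFi.div_const Z
  have hp1 : ∫ U, F U / Z ∂π = 1 := by
    rw [integral_div, ← hZ, div_self hZpos.ne']
  -- the log is bounded below too, so the integrand is integrable
  have hlogb : ∀ U, |Real.log (F U / Z)| ≤ 2 * (|β| * B) + |Real.log Z| := fun U => by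
    rw [Real.log_div (Real.exp_pos _).ne' hZpos.ne']
    simp only [Real.log_exp]
    have h1 : |-β * wilsonAction ρ U| ≤ |β| * B := by
      have := hFhi U; have := hFlo U
      rw [abs_le]
      constructor
      · have h := Real.exp_le_exp.1 (hFlo U); linarith
      · have h := Real.exp_le_exp.1 (hFhi U); linarith
    calc |-β * wilsonAction ρ U - Real.log Z| ≤ |-β * wilsonAction ρ U| + |Real.log Z| := abs_sub _ _
      _ ≤ 2 * (|β| * B) + |Real.log Z| := by linarith [abs_nonneg (β), h1, abs_nonneg (|β| * B),
          show 0 ≤ |β| * B from (abs_nonneg _).trans h1]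
  have hint : Integrable (fun U => F U / Z * Real.log (F U / Z)) π := by
    refine Integrable.mono' ((hpi.norm).mul_const (2 * (|β| * B) + |Real.log Z|)) ?_ ?_
    · exact (hpi.aestronglyMeasurable.mul
        ((Real.measurable_log.comp (hFm.div_const Z)).aestronglyMeasurable))
    · refine ae_of_all _ fun U => ?_
      rw [Real.norm_eq_abs, abs_mul, Real.norm_eq_abs]
      exact mul_le_mul_of_nonneg_left (hlogb U) (abs_nonneg _)
  calc ∫ U, F U / Z * Real.log (F U / Z) ∂π ≤ ∫ U, F U / Z * C ∂π :=
        integral_mono hint (hpi.mul_const C) hpt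
    _ = C := by rw [integral_mul_const, hp1, one_mul]

/-- **The flat autoregressive model attains the linear order**: for every list `l` of ALL links, the lineage's
hybrid divergence `KL(F/Z ‖ H_l)` of the model with all conditionals `q_a ≡ 1` (independent Haar links —
blind to everything, in particular to the links at either endpoint) is `≤ 4|β|·N·#plaquettes`. [ours] -/
theorem wilson_kl_arHybrid_flat_le (hρ : Continuous ρ) (β : ℝ) (l : List (Edge d L))
    (hall : ∀ e : Edge d L, e ∈ l) :
    ∫ U, Real.exp (-β * wilsonAction ρ U) /
          (∫ W, Real.exp (-β * wilsonAction ρ W) ∂Measure.pi (fun _ : Edge d L => haarProbability G)) *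
        Real.log ((Real.exp (-β * wilsonAction ρ U) /
            ∫ W, Real.exp (-β * wilsonAction ρ W) ∂Measure.pi (fun _ : Edge d L => haarProbability G)) /
          ((l.map fun _ : Edge d L => (fun _ : GaugeConfig d L G => (1 : ℝ)) U).prod *
              coordAvg (haarProbability G) l.toFinset
                (fun V : GaugeConfig d L G => Real.exp (-β * wilsonAction ρ V)) U /
            ∫ W, Real.exp (-β * wilsonAction ρ W) ∂Measure.pi (fun _ : Edge d L => haarProbability G)))
      ∂Measure.pi (fun _ : Edge d L => haarProbability G) ≤
      4 * |β| * N * Fintype.card (Plaquette d L) := by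
  have hl : l.toFinset = Finset.univ := Finset.eq_univ_of_forall fun e => List.mem_toFinset.2 (hall e)
  have hprod : ∀ U : GaugeConfig d L G,
      (l.map fun _ : Edge d L => (fun _ : GaugeConfig d L G => (1 : ℝ)) U).prod = 1 := fun U => by
    simp
  have hZpos : 0 < ∫ W, Real.exp (-β * wilsonAction ρ W) ∂Measure.pi (fun _ : Edge d L => haarProbability G) :=
    integral_exp_pos (Literature.Probability.LatticeModels.integrable_of_continuous_compactSpace _
      (Real.continuous_exp.comp (continuous_const.mul (continuous_wilsonAction ρ hρ))))
  have hden : ∀ U : GaugeConfig d L G,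
      (l.map fun _ : Edge d L => (fun _ : GaugeConfig d L G => (1 : ℝ)) U).prod *
          coordAvg (haarProbability G) l.toFinset
            (fun V : GaugeConfig d L G => Real.exp (-β * wilsonAction ρ V)) U /
        ∫ W, Real.exp (-β * wilsonAction ρ W) ∂Measure.pi (fun _ : Edge d L => haarProbability G) = 1 := by
    intro U
    have h2 : coordAvg (haarProbability G) l.toFinset
        (fun V : GaugeConfig d L G => Real.exp (-β * wilsonAction ρ V)) U =
        ∫ W, Real.exp (-β * wilsonAction ρ W) ∂Measure.pi (fun _ : Edge d L => haarProbability G) := by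
      rw [hl]
      exact coordAvg_univ (haarProbability G) (fun V : GaugeConfig d L G => Real.exp (-β * wilsonAction ρ V)) U
    rw [hprod U, one_mul, h2, div_self hZpos.ne']
  simp_rw [hden, div_one]
  exact wilson_kl_flat_le (d := d) (L := L) ρ hρ β

end Summit.Ventures.LatticeQCDFlow.Theory2.Autoregressive

end
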